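import Summits.CriticalPhenomena.PercolationContinuityZ3.Theorems.PercNearOneGluingNoHeavyLowerTailKnQuestion8CoefficientwiseCoreClassKernelMixPathTransfer
import HarnessLib

/-!
# The partial colour swap σ: keep the red cluster of the root, keep its boundary blue, complement the rest

Support file (`--supports stmt-CriticalPhenomena-4575`, closed), prover `prim-cplus-coupling` (gen 39).  No definitions, no notations, no named facts,
no sorries; standard axioms.  Memo `prim-cplus-coupling/A5-COUPLING-gen39.md` §2.2, §4.3.

The FIBRE INJECTION LEMMA (`…KernelMixFibreInjection`) needs, on the fibre `{W blue} × 2^A` of CONJECTURE IET, an injection `σ` of the demand points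
with nontrivial red cluster into the partner set `2^A ∖ {∅, A}` such that the partner `σ(η) ∪ W` red-connects both the red cluster `X(η) = C_u(η)` and
the blue cluster `Y(η)`.  On a cycle `σ` keeps the red run at `u`, keeps the next (blue) edge, and complements the rest of the arc (memo §2.2).  This file
gives the GRAPH-THEORETIC form of `σ`, valid for EVERY edge set `A` (memo §4.3): with `S = C_u(η)`, `In = {e ∈ A : all ends of e in S}`,
`Out = {e ∈ A : no end of e in S}`,
  `σ(η) = (η ∩ In) ∪ (Out ∖ η)`   (red cluster kept, crossing edges kept blue, everything away from `S` complemented),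
and proves: `C_u(σ η) = C_u(η)` (`openCluster_sigmaFlip`), hence `σ` is an INVOLUTION on the colourings of `A` (`sigmaFlip_sigmaFlip`) — in particular
injective on any family — with `σ(η) ⊆ A`, `σ(η) ≠ A` as soon as `b ∈ C_u(A) ∖ C_u(η)` (a crossing edge exists), and `σ(η) ≠ ∅` as soon as `η` has an
edge inside `C_u(η)`.  Covering of the BLUE cluster by `C_u(σ(η) ∪ W)` is the graph-specific part (true on cycles, false with pendant edges at the
boundary of `S`) and is not treated here.
[cite: KozmaNitzan2024, Questions 8–9 (§5.5 p. 36) (context: the Question-8 pocket covariance programme)]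
-/

namespace Summit.CriticalPhenomena.PercolationContinuityZ3.Theorems

open Finset Literature.Probability.Percolation

namespace Coefficientwise

variable {ι V : Type*}

/-- Every unordered pair has a representative. [folklore] -/
theorem sym2_exists_rep (z : Sym2 V) : ∃ a b : V, z = s(a, b) :=
  Sym2.ind (fun a b => ⟨a, b, rfl⟩) z

open Classical in
/-- An edge of the colouring `η` lies either inside the red cluster `S = C_u(η)` (all ends in `S`) or away from it (no end in `S`): a red edge with
one end in `S` has its other end in `S`. [cite: KozmaNitzan2024, §5.5 (context only; folklore)] -/
theorem sigmaFlip_red_subset (ends : ι → Sym2 V) (A η : Finset ι) (u : V) (hη : η ⊆ A) :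
    η ⊆ A.filter (fun e => ∀ x, x ∈ ends e → x ∈ openCluster (ends '' (↑η : Set ι)) u)
      ∪ A.filter (fun e => ∀ x, x ∈ ends e → x ∉ openCluster (ends '' (↑η : Set ι)) u) := by
  intro e he
  rw [Finset.mem_union, Finset.mem_filter, Finset.mem_filter]
  obtain ⟨a, b, hab⟩ := sym2_exists_rep (ends e)
  by_cases ha : a ∈ openCluster (ends '' (↑η : Set ι)) u
  · left
    refine ⟨hη he, fun x hx => ?_⟩
    rw [hab, Sym2.mem_iff] at hx
    rcases hx with rfl | rfl
    · exact ha
    · exact mem_openCluster_of_edge ends he hab ha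
  · by_cases hb : b ∈ openCluster (ends '' (↑η : Set ι)) u
    · left
      refine ⟨hη he, fun x hx => ?_⟩
      rw [hab, Sym2.mem_iff] at hx
      rcases hx with rfl | rfl
      · exact mem_openCluster_of_edge ends he (hab.trans Sym2.eq_swap) hb
      · exact hb
    · right
      refine ⟨hη he, fun x hx => ?_⟩
      rw [hab, Sym2.mem_iff] at hx
      rcases hx with rfl | rfl
      · exact ha
      · exact hb

open Classical in
/-- **`σ` preserves the red cluster of the root**: `C_u((η ∩ In) ∪ (Out ∖ η)) = C_u(η)`.  (`⊆`: the set `S = C_u(η)` is closed under the edges of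
`σ(η)` — inner edges stay inside, outer edges never touch `S`; `⊇`: `S` is already generated by the inner red edges `η ∩ In`.)
[cite: KozmaNitzan2024, §5.5 (context only; folklore)] -/
theorem openCluster_sigmaFlip (ends : ι → Sym2 V) (A η : Finset ι) (u : V) (hη : η ⊆ A) :
    openCluster (ends '' (↑((η ∩ A.filter (fun e => ∀ x, x ∈ ends e → x ∈ openCluster (ends '' (↑η : Set ι)) u))
        ∪ (A.filter (fun e => ∀ x, x ∈ ends e → x ∉ openCluster (ends '' (↑η : Set ι)) u) \ η)) : Set ι)) u
      = openCluster (ends '' (↑η : Set ι)) u := by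
  set S : Set V := openCluster (ends '' (↑η : Set ι)) u with hS
  set In : Finset ι := A.filter (fun e => ∀ x, x ∈ ends e → x ∈ S) with hIn
  set Out : Finset ι := A.filter (fun e => ∀ x, x ∈ ends e → x ∉ S) with hOut
  apply Set.Subset.antisymm
  · -- `S` is closed under the edges of σ(η)
    refine openCluster_subset_of_closed ends _ u (S := S) (mem_openCluster_self _ _) ?_
    intro i hi a b he ha
    rcases Finset.mem_union.mp hi with hi | hi
    · have hin := (Finset.mem_filter.mp (Finset.mem_inter.mp hi).2).2
      exact hin b (by rw [he]; exact Sym2.mem_mk_right a b)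
    · have hout := (Finset.mem_filter.mp (Finset.mem_sdiff.mp hi).1).2
      exact absurd ha (hout a (by rw [he]; exact Sym2.mem_mk_left a b))
  · -- `S` is generated by the inner red edges
    have hsub : S ⊆ openCluster (ends '' (↑(η ∩ In) : Set ι)) u := by
      refine openCluster_subset_of_closed ends η u (S := openCluster (ends '' (↑(η ∩ In) : Set ι)) u) (mem_openCluster_self _ _) ?_
      intro i hi a b he ha
      have haS : a ∈ S := openCluster_image_mono ends Finset.inter_subset_left u ha
      have hbS : b ∈ S := mem_openCluster_of_edge ends hi he haS
      have hiIn : i ∈ In := by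
        refine Finset.mem_filter.mpr ⟨hη hi, fun x hx => ?_⟩
        rw [he, Sym2.mem_iff] at hx
        rcases hx with rfl | rfl
        · exact haS
        · exact hbS
      exact mem_openCluster_of_edge ends (Finset.mem_inter.mpr ⟨hi, hiIn⟩) he ha
    exact le_trans hsub (openCluster_image_mono ends Finset.subset_union_left u)

open Classical in
/-- **`σ` is an involution** on the colourings of `A`: with `In, Out` computed from `C_u(η)` (which equals `C_u(σ η)` by `openCluster_sigmaFlip`, so
that `σ` applied to `σ(η)` uses the same `In, Out`), `(σ(η) ∩ In) ∪ (Out ∖ σ(η)) = η` for `η ⊆ A`.  Hence `σ` is injective on every family of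
colourings of `A`. [cite: KozmaNitzan2024, §5.5 (context only; folklore)] -/
theorem sigmaFlip_sigmaFlip (ends : ι → Sym2 V) (A η : Finset ι) (u : V) (hη : η ⊆ A) :
    (((η ∩ A.filter (fun e => ∀ x, x ∈ ends e → x ∈ openCluster (ends '' (↑η : Set ι)) u))
        ∪ (A.filter (fun e => ∀ x, x ∈ ends e → x ∉ openCluster (ends '' (↑η : Set ι)) u) \ η))
        ∩ A.filter (fun e => ∀ x, x ∈ ends e → x ∈ openCluster (ends '' (↑η : Set ι)) u))
      ∪ (A.filter (fun e => ∀ x, x ∈ ends e → x ∉ openCluster (ends '' (↑η : Set ι)) u)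
        \ ((η ∩ A.filter (fun e => ∀ x, x ∈ ends e → x ∈ openCluster (ends '' (↑η : Set ι)) u))
          ∪ (A.filter (fun e => ∀ x, x ∈ ends e → x ∉ openCluster (ends '' (↑η : Set ι)) u) \ η)))
      = η := by
  set S : Set V := openCluster (ends '' (↑η : Set ι)) u with hS
  set In : Finset ι := A.filter (fun e => ∀ x, x ∈ ends e → x ∈ S) with hIn
  set Out : Finset ι := A.filter (fun e => ∀ x, x ∈ ends e → x ∉ S) with hOut
  -- In and Out are disjoint (an edge has an end)
  have hdis : ∀ e, e ∈ In → e ∈ Out → False := by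
    intro e h1 h2
    obtain ⟨a, b, hab⟩ := sym2_exists_rep (ends e)
    have ha : a ∈ ends e := by rw [hab]; exact Sym2.mem_mk_left a b
    exact (Finset.mem_filter.mp h2).2 a ha ((Finset.mem_filter.mp h1).2 a ha)
  have hcover := sigmaFlip_red_subset ends A η u hη
  ext e
  simp only [Finset.mem_union, Finset.mem_inter, Finset.mem_sdiff]
  constructor
  · rintro (⟨⟨heη, _⟩ | ⟨heOut, _⟩, heIn⟩ | ⟨heOut, hnot⟩)
    · exact heη
    · exact (hdis e heIn heOut).elim
    · by_contra heη
      exact hnot (Or.inr ⟨heOut, heη⟩)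
  · intro heη
    rcases Finset.mem_union.mp (hcover heη) with heIn | heOut
    · exact Or.inl ⟨Or.inl ⟨heη, heIn⟩, heIn⟩
    · refine Or.inr ⟨heOut, ?_⟩
      rintro (⟨_, heIn⟩ | ⟨_, hne⟩)
      · exact hdis e heIn heOut
      · exact hne heη

open Classical in
/-- `σ(η)` misses every CROSSING edge; so if `b` is joined to `u` inside `A` but not inside `η`, then `σ(η) ≠ A`.
[cite: KozmaNitzan2024, §5.5 (context only; folklore)] -/
theorem sigmaFlip_ne_top (ends : ι → Sym2 V) (A η : Finset ι) (u b : V)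
    (hbA : b ∈ openCluster (ends '' (↑A : Set ι)) u) (hbη : b ∉ openCluster (ends '' (↑η : Set ι)) u) :
    (η ∩ A.filter (fun e => ∀ x, x ∈ ends e → x ∈ openCluster (ends '' (↑η : Set ι)) u))
        ∪ (A.filter (fun e => ∀ x, x ∈ ends e → x ∉ openCluster (ends '' (↑η : Set ι)) u) \ η) ≠ A := by
  set S : Set V := openCluster (ends '' (↑η : Set ι)) u with hS
  intro hEq
  -- then every edge of A is inner or outer, so S is closed under A, so b ∈ S
  apply hbη
  refine openCluster_subset_of_closed ends A u (S := S) (mem_openCluster_self _ _) ?_ hbA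
  intro i hi a c he ha
  rw [← hEq] at hi
  rcases Finset.mem_union.mp hi with hi | hi
  · exact (Finset.mem_filter.mp (Finset.mem_inter.mp hi).2).2 c (by rw [he]; exact Sym2.mem_mk_right a c)
  · exact absurd ha ((Finset.mem_filter.mp (Finset.mem_sdiff.mp hi).1).2 a (by rw [he]; exact Sym2.mem_mk_left a c))

open Classical in
/-- If `η` has an edge of `A` with an end in the red cluster `C_u(η)`, that edge is inner and survives in `σ(η)`; in particular `σ(η) ≠ ∅`.
[cite: KozmaNitzan2024, §5.5 (context only; folklore)] -/
theorem sigmaFlip_ne_empty (ends : ι → Sym2 V) (A η : Finset ι) (u : V) (hη : η ⊆ A)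
    (hex : ∃ e ∈ η, ∃ x, x ∈ ends e ∧ x ∈ openCluster (ends '' (↑η : Set ι)) u) :
    (η ∩ A.filter (fun e => ∀ x, x ∈ ends e → x ∈ openCluster (ends '' (↑η : Set ι)) u))
        ∪ (A.filter (fun e => ∀ x, x ∈ ends e → x ∉ openCluster (ends '' (↑η : Set ι)) u) \ η) ≠ ∅ := by
  obtain ⟨e, he, x, hx, hxS⟩ := hex
  rcases Finset.mem_union.mp (sigmaFlip_red_subset ends A η u hη he) with heIn | heOut
  · intro h0
    have : e ∈ (∅ : Finset ι) := by
      rw [← h0]; exact Finset.mem_union.mpr (Or.inl (Finset.mem_inter.mpr ⟨he, heIn⟩))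
    exact absurd this (Finset.notMem_empty e)
  · exact absurd hxS ((Finset.mem_filter.mp heOut).2 x hx)

end Coefficientwise

end Summit.CriticalPhenomena.PercolationContinuityZ3.Theorems
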